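import Summits.AtomisticToContinuum.Crystallization.Theorems.ChessboardParticlePlanesPeriodicWindowsStubOffsetLayerDecay

/-!
# Crux `PeriodicWindows` (stmt-AtomisticToContinuum-3240), line `dense-laminar-hull` — stub HC, helper
# `hc_countSharp`: sharp uniform counting of shifted triangular-lattice points in a disc

For the triangular layer lattice `{i v₁(a) + j v₂(a)}` (`a > 0`), a HORIZONTAL offset `θ` (`θ 2 = 0`), a level
`m ≥ 0` and any finite `F ⊆ ℤ²`:
`#{(i,j) ∈ F : ‖i v₁ + j v₂ + θ‖² < m} ≤ (4√(m/3)/a + 1) (2√m/a + 1)`.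

Route (the coordinate-box argument of `old_card_filter_lt_le`, keeping the product form and the spacing `a`, and
allowing `m ≥ 0`): `‖i v₁ + j v₂ + θ‖² = a² ((i + j/2 + c₁)² + ¾ (j + c₂)²)` with `c₁ = θ₀/a`, `c₂ = 2√3 θ₁/(3a)`
(`old_norm_sq_horiz`), so the condition forces `|j + c₂| < r₂ = 2√(m/3)/a` and `|i + j/2 + c₁| < r₁ = √m/a`; the
integers within `r ≥ 0` of a real centre number at most `2r + 1`, and the filtered set is
contained in the union over the `j`-box of the `i`-boxes, of cardinality `≤ (2r₂ + 1)(2r₁ + 1)`.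
All elementary. [folklore]
-/

noncomputable section

namespace Summit.AtomisticToContinuum.Crystallization.Theorems.PeriodicWindowsDenseLaminarHull

open Literature.MathematicalPhysics.StatisticalMechanics Filter Metric
open scoped BigOperators

/-- **Scaled cumulative planar count, arbitrary real shifts**: in any finite `F ⊆ ℤ²`, the points with
`a² ((i + j/2 + c₁)² + ¾ (j + c₂)²) < m` (`a > 0`, `m ≥ 0`) number at most `(4√(m/3)/a + 1)(2√m/a + 1)`
(the `j`-coordinate ranges over the integers within `2√(m/3)/a` of `-c₂`, and for fixed `j` the `i`-coordinate over
the integers within `√m/a` of `-j/2 - c₁`). [folklore] -/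
theorem hcs2_card_filter_lt_le {a : ℝ} (ha : 0 < a) (c₁ c₂ : ℝ) (F : Finset (ℤ × ℤ)) {m : ℝ} (hm : 0 ≤ m) :
    ((F.filter fun ij : ℤ × ℤ =>
        a ^ 2 * (((ij.1 : ℝ) + ij.2 / 2 + c₁) ^ 2 + 3 / 4 * ((ij.2 : ℝ) + c₂) ^ 2) < m).card : ℝ) ≤
      (4 * Real.sqrt (m / 3) / a + 1) * (2 * Real.sqrt m / a + 1) := by
  classical
  -- adapted from `old_card_filter_lt_le` (normalised form, `m ≥ 1`, crude final bound `10 m`)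
  -- integers within `r ≥ 0` of a real centre `c`: at most `2r + 1` of them
  have card_Icc_le : ∀ (c r : ℝ), 0 ≤ r → ((Finset.Icc ⌈c - r⌉ ⌊c + r⌋).card : ℝ) ≤ 2 * r + 1 := by
    intro c r hr
    rw [Int.card_Icc]
    have h1 : (⌊c + r⌋ : ℝ) ≤ c + r := Int.floor_le _
    have h2 : c - r ≤ (⌈c - r⌉ : ℝ) := Int.le_ceil _
    rcases le_or_gt (⌊c + r⌋ + 1 - ⌈c - r⌉) 0 with h | h
    · rw [Int.toNat_of_nonpos h]; simp; linarith
    · rw [show (((⌊c + r⌋ + 1 - ⌈c - r⌉).toNat : ℕ) : ℝ) = ((⌊c + r⌋ + 1 - ⌈c - r⌉ : ℤ) : ℝ) by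
        rw [← Int.cast_natCast, Int.toNat_of_nonneg h.le]]
      push_cast; linarith
  set r₁ : ℝ := Real.sqrt m / a with hr₁
  set r₂ : ℝ := 2 * Real.sqrt (m / 3) / a with hr₂
  have hr₁0 : 0 ≤ r₁ := by positivity
  have hr₂0 : 0 ≤ r₂ := by positivity
  have ha2 : 0 < a ^ 2 := by positivity
  have hsq1 : r₁ ^ 2 = m / a ^ 2 := by rw [hr₁, div_pow, Real.sq_sqrt hm]
  have hsq2 : r₂ ^ 2 = 4 / 3 * (m / a ^ 2) := by
    rw [hr₂, div_pow, mul_pow, Real.sq_sqrt (by positivity)]; ring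
  -- the `j`-range and, for each `j`, the `i`-range
  set J : Finset ℤ := Finset.Icc ⌈-c₂ - r₂⌉ ⌊-c₂ + r₂⌋ with hJ
  set I : ℤ → Finset ℤ := fun j => Finset.Icc ⌈(-(j : ℝ) / 2 - c₁) - r₁⌉ ⌊(-(j : ℝ) / 2 - c₁) + r₁⌋ with hI
  set G : Finset (ℤ × ℤ) := J.biUnion fun j => (I j).image fun i => (i, j) with hG
  have hsub : (F.filter fun ij : ℤ × ℤ =>
      a ^ 2 * (((ij.1 : ℝ) + ij.2 / 2 + c₁) ^ 2 + 3 / 4 * ((ij.2 : ℝ) + c₂) ^ 2) < m) ⊆ G := by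
    intro ij hij
    rw [Finset.mem_filter] at hij
    obtain ⟨-, hlt⟩ := hij
    have hlt' : ((ij.1 : ℝ) + ij.2 / 2 + c₁) ^ 2 + 3 / 4 * ((ij.2 : ℝ) + c₂) ^ 2 < m / a ^ 2 :=
      (lt_div_iff₀' ha2).2 hlt
    have hX : |(ij.1 : ℝ) - (-(ij.2 : ℝ) / 2 - c₁)| < r₁ := by
      rw [show (ij.1 : ℝ) - (-(ij.2 : ℝ) / 2 - c₁) = ij.1 + ij.2 / 2 + c₁ by ring]
      refine abs_lt_of_sq_lt_sq ?_ hr₁0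
      rw [hsq1]
      nlinarith [sq_nonneg ((ij.2 : ℝ) + c₂)]
    have hY : |(ij.2 : ℝ) - (-c₂)| < r₂ := by
      rw [show (ij.2 : ℝ) - (-c₂) = ij.2 + c₂ by ring]
      refine abs_lt_of_sq_lt_sq ?_ hr₂0
      rw [hsq2]
      nlinarith [sq_nonneg ((ij.1 : ℝ) + ij.2 / 2 + c₁)]
    rw [hG, Finset.mem_biUnion]
    exact ⟨ij.2, mem_Icc_ceil_floor hY, Finset.mem_image.2 ⟨ij.1, mem_Icc_ceil_floor hX, rfl⟩⟩
  have hcardG : (G.card : ℝ) ≤ (2 * r₂ + 1) * (2 * r₁ + 1) := by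
    calc (G.card : ℝ) ≤ ∑ j ∈ J, (((I j).image fun i => (i, j)).card : ℝ) := by
          exact_mod_cast Finset.card_biUnion_le
      _ ≤ ∑ _j ∈ J, (2 * r₁ + 1) := by
          refine Finset.sum_le_sum fun j _ => ?_
          calc ((((I j).image fun i => (i, j)).card : ℕ) : ℝ) ≤ ((I j).card : ℝ) := by
                exact_mod_cast Finset.card_image_le
            _ ≤ 2 * r₁ + 1 := card_Icc_le _ _ hr₁0
      _ = J.card * (2 * r₁ + 1) := by rw [Finset.sum_const, nsmul_eq_mul]
      _ ≤ (2 * r₂ + 1) * (2 * r₁ + 1) := by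
          gcongr
          exact card_Icc_le _ _ hr₂0
  calc ((F.filter fun ij : ℤ × ℤ =>
        a ^ 2 * (((ij.1 : ℝ) + ij.2 / 2 + c₁) ^ 2 + 3 / 4 * ((ij.2 : ℝ) + c₂) ^ 2) < m).card : ℝ)
      ≤ G.card := by exact_mod_cast Finset.card_le_card hsub
    _ ≤ (2 * r₂ + 1) * (2 * r₁ + 1) := hcardG
    _ = (4 * Real.sqrt (m / 3) / a + 1) * (2 * Real.sqrt m / a + 1) := by rw [hr₁, hr₂]; ring

/-- **Stub HC helper `hc_countSharp` (sharp uniform lattice counting).** For `a > 0`, a horizontal offset `θ`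
(`θ 2 = 0`), a level `m ≥ 0` and any finite `F ⊆ ℤ²`, the points `(i,j) ∈ F` of the shifted triangular layer with
`‖i v₁ + j v₂ + θ‖² < m` number at most `(4√(m/3)/a + 1)(2√m/a + 1)`: in the coordinates of `old_norm_sq_horiz`,
`‖i v₁ + j v₂ + θ‖² = a² ((i + j/2 + c₁)² + ¾ (j + c₂)²)`, and `hcs2_card_filter_lt_le` counts the integer points of
the resulting coordinate boxes. [folklore] -/
theorem hc_countSharp : ∀ a : ℝ, 0 < a → ∀ θ : EuclideanSpace ℝ (Fin 3), θ 2 = 0 → ∀ m : ℝ, 0 ≤ m →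
    ∀ F : Finset (ℤ × ℤ), (((F.filter fun ij : ℤ × ℤ =>
      ‖((ij.1 : ℝ)) • triangularVec₁ a + ((ij.2 : ℝ)) • triangularVec₂ a + θ‖ ^ 2 < m)).card : ℝ) ≤
      (4 * Real.sqrt (m / 3) / a + 1) * (2 * Real.sqrt m / a + 1) := by
  intro a ha θ hθ m hm F
  classical
  have hnorm : ∀ ij : ℤ × ℤ, ‖((ij.1 : ℝ)) • triangularVec₁ a + ((ij.2 : ℝ)) • triangularVec₂ a + θ‖ ^ 2 =
      a ^ 2 * (((ij.1 : ℝ) + ij.2 / 2 + θ 0 / a) ^ 2 + 3 / 4 * ((ij.2 : ℝ) + 2 * √3 * θ 1 / (3 * a)) ^ 2) :=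
    fun ij => (old_norm_sq_horiz ha.ne' θ hθ _ _).2
  have hfilter : (F.filter fun ij : ℤ × ℤ =>
      ‖((ij.1 : ℝ)) • triangularVec₁ a + ((ij.2 : ℝ)) • triangularVec₂ a + θ‖ ^ 2 < m) =
      F.filter fun ij : ℤ × ℤ =>
        a ^ 2 * (((ij.1 : ℝ) + ij.2 / 2 + θ 0 / a) ^ 2 + 3 / 4 * ((ij.2 : ℝ) + 2 * √3 * θ 1 / (3 * a)) ^ 2) < m :=
    Finset.filter_congr fun ij _ => by rw [hnorm]
  rw [hfilter]
  exact hcs2_card_filter_lt_le ha _ _ F hm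

end Summit.AtomisticToContinuum.Crystallization.Theorems.PeriodicWindowsDenseLaminarHull

end
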